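import Mathlib.NumberTheory.Padics.RingHoms
import Mathlib.NumberTheory.Padics.ProperSpace
import Mathlib.LinearAlgebra.FreeModule.PID
import Mathlib.LinearAlgebra.Dimension.Constructions
import Mathlib.LinearAlgebra.Pi
import Mathlib.Topology.Algebra.ContinuousMonoidHom
import Mathlib.Topology.Homeomorph.Lemmas
import Literature.AnabelianGeometry.AbsoluteAnabelian.ProfiniteTerminology
import HarnessLib

/-!
# The free pro-`l` rank `δ¹_l` as a number of linearly independent characters

Proof-only companion (no definitions, no named facts) for the rank computations of
S. Mochizuki, *The Absolute Anabelian Geometry of Hyperbolic Curves* (2004) [AbsAnab], proof of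
Lemma 1.1.4 (ii), manuscript p. 8 (lit key `paper:url-e8f118cc205e`), where `δ¹_l(Π)` enters as
`dim_{ℚ_l}(Π^{ab} ⊗ ℚ_l)`.  The tree's `freeProlRank G l` ([AbsAnab] §0 / [AbsTopI] Thm 2.6) is the
supremum of the `n` with a continuous surjection `G ↠ ℤ_lⁿ`; this file proves the DICTIONARY with
continuous characters `G → ℤ_l`:

* `linearIndependent_of_surjective` / `exists_linearIndependent_of_le_freeProlRank` — a continuous
  surjection `G ↠ ℤ_l^N`, `n ≤ N`, yields `n` continuous homomorphisms `G → ℤ_l` that are linearly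
  independent over `ℚ_l` as `ℚ_l`-valued functions on `G`; hence so does `n ≤ δ¹_l(G)`;
* `le_freeProlRank_of_linearIndependent` — conversely, for COMPACT `G`, `n` continuous homomorphisms
  `G → ℤ_l` that are `ℚ_l`-linearly independent give a continuous surjection `G ↠ ℤ_lⁿ`, so
  `n ≤ δ¹_l(G)`: the joint image is a closed, hence `ℤ_l`-stable, subgroup of `ℤ_lⁿ` (`ℕ` is dense in
  `ℤ_l`), a free `ℤ_l`-module by the structure theory over the PID `ℤ_l` (Smith normal form), of
  full rank `n` because a missing Smith index would produce a nonzero `ℤ_l`-linear relation among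
  the characters; a `ℤ_l`-basis then identifies the image with `ℤ_lⁿ` bicontinuously
  (continuous bijection from the compact `ℤ_lⁿ`).

So `δ¹_l(G) = rank_{ℤ_l} Hom_cont(G, ℤ_l) = dim_{ℚ_l} (Hom_cont(G, ℤ_l) ⊗ ℚ_l)` for compact `G`,
which is the form used on p. 8 of [AbsAnab].  HONEST FRAMING: classical profinite group theory;
nothing here bears on [IUTchIII] Cor. 3.12.
-/

noncomputable section

open Topology

universe u

namespace Literature.AnabelianGeometry.AbsoluteAnabelian

variable {H : Type u} [Group H] [TopologicalSpace H]

/-! ### Unfolding the supremum (local copies; cf. `FreeProlRankCompletionProofs`) -/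

/-- A continuous surjection `G ↠ ℤ_lⁿ` witnesses `n ≤ δ¹_l(G)`. [cite: MochizukiAbsTopI2012, Thm 2.6 p.21] -/
private theorem le_freeProlRank_of_surjective_aux (l : ℕ) [Fact l.Prime] {n : ℕ}
    (f : H →ₜ* Multiplicative (Fin n → ℤ_[l])) (hf : Function.Surjective f) :
    (n : ℕ∞) ≤ freeProlRank H l := by
  unfold freeProlRank
  exact le_iSup₂_of_le n ⟨f, hf⟩ le_rfl

/-- `δ¹_l(G) ≤ N` as soon as every continuous surjection `G ↠ ℤ_lⁿ` has `n ≤ N`.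
[cite: MochizukiAbsTopI2012, Thm 2.6 p.21] -/
private theorem freeProlRank_le_of_forall_aux (l : ℕ) [Fact l.Prime] {N : ℕ∞}
    (h : ∀ (n : ℕ) (f : H →ₜ* Multiplicative (Fin n → ℤ_[l])), Function.Surjective f →
      (n : ℕ∞) ≤ N) :
    freeProlRank H l ≤ N := by
  unfold freeProlRank
  refine iSup₂_le fun n hn => ?_
  obtain ⟨f, hf⟩ := hn
  exact h n f hf

/-! ### From a surjection onto `ℤ_l^N` to independent characters -/

/-- The coordinates of a continuous surjection `G ↠ ℤ_l^N` are `ℚ_l`-linearly independent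
`ℚ_l`-valued functions on `G` (evaluate a relation at preimages of the basis vectors).
[cite: MochizukiAbsAnab2004, Lemma 1.1.4 (ii) proof p.8] -/
theorem linearIndependent_of_surjective (l : ℕ) [Fact l.Prime] {N : ℕ}
    (F : H →ₜ* Multiplicative (Fin N → ℤ_[l])) (hF : Function.Surjective F) :
    LinearIndependent ℚ_[l]
      (fun (i : Fin N) (h : H) => ((Multiplicative.toAdd (F h) i : ℤ_[l]) : ℚ_[l])) := by
  classical
  rw [Fintype.linearIndependent_iff]
  intro g hg j
  obtain ⟨h, hh⟩ := hF (Multiplicative.ofAdd (Pi.single j 1))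
  have h0 := congrFun hg h
  simp only [Finset.sum_apply, Pi.smul_apply, smul_eq_mul, Pi.zero_apply] at h0
  rw [Finset.sum_eq_single j] at h0
  · simpa [hh] using h0
  · intro i _ hij
    simp [hh, hij]
  · intro hj; exact absurd (Finset.mem_univ j) hj

/-- If `0 < n ≤ δ¹_l(G)` then `G` surjects continuously onto some `ℤ_l^N` with `n ≤ N` (unfolding
of the supremum defining the typed `δ¹_l`). [cite: MochizukiAbsTopI2012, Thm 2.6 p.21] -/
theorem exists_surjective_of_le_freeProlRank (l : ℕ) [Fact l.Prime] {n : ℕ} (hn0 : 0 < n)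
    (hn : (n : ℕ∞) ≤ freeProlRank H l) :
    ∃ (N : ℕ) (F : H →ₜ* Multiplicative (Fin N → ℤ_[l])), n ≤ N ∧ Function.Surjective F := by
  by_contra hne
  push Not at hne
  have hle : freeProlRank H l ≤ ((n - 1 : ℕ) : ℕ∞) := by
    refine freeProlRank_le_of_forall_aux l fun N F hF => ?_
    have hlt : N < n := by
      by_contra h
      exact hne N F (not_lt.mp h) hF
    exact_mod_cast (by omega : N ≤ n - 1)
  have h := hn.trans hle
  have h' : n ≤ n - 1 := by exact_mod_cast h
  omega

/-- **`n ≤ δ¹_l(G)` gives `n` independent characters**: there are `n` continuous homomorphisms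
`G → ℤ_l` which, as `ℚ_l`-valued functions on `G`, are linearly independent over `ℚ_l`.
[cite: MochizukiAbsAnab2004, Lemma 1.1.4 (ii) proof p.8] -/
theorem exists_linearIndependent_of_le_freeProlRank (l : ℕ) [Fact l.Prime] {n : ℕ}
    (hn : (n : ℕ∞) ≤ freeProlRank H l) :
    ∃ φ : Fin n → (H →ₜ* Multiplicative ℤ_[l]),
      LinearIndependent ℚ_[l]
        (fun (i : Fin n) (h : H) => ((Multiplicative.toAdd (φ i h) : ℤ_[l]) : ℚ_[l])) := by
  classical
  rcases Nat.eq_zero_or_pos n with rfl | hn0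
  · exact ⟨Fin.elim0, linearIndependent_empty_type⟩
  obtain ⟨N, F, hnN, hF⟩ := exists_surjective_of_le_freeProlRank l hn0 hn
  -- the coordinate characters of `F`
  let π : Fin N → (Multiplicative (Fin N → ℤ_[l]) →ₜ* Multiplicative ℤ_[l]) := fun i =>
    { toFun := fun x => Multiplicative.ofAdd (Multiplicative.toAdd x i)
      map_one' := by simp
      map_mul' := fun x y => by
        rw [← ofAdd_add]; rfl
      continuous_toFun :=
        continuous_ofAdd.comp ((continuous_apply i).comp continuous_toAdd) }
  refine ⟨fun i => (π (Fin.castLE hnN i)).comp F, ?_⟩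
  have hind := linearIndependent_of_surjective l F hF
  -- restrict the independent family of all `N` coordinates along the injection `Fin n ↪ Fin N`
  have h2 := hind.comp (Fin.castLE hnN) (Fin.castLE_injective hnN)
  have heq : (fun (i : Fin n) (h : H) =>
      ((Multiplicative.toAdd (((π (Fin.castLE hnN i)).comp F) h) : ℤ_[l]) : ℚ_[l])) =
      (fun (i : Fin N) (h : H) => ((Multiplicative.toAdd (F h) i : ℤ_[l]) : ℚ_[l])) ∘
        Fin.castLE hnN := by
    funext i h; rfl
  rw [heq]
  exact h2

/-! ### From independent characters to a surjection onto `ℤ_lⁿ` (compact `G`) -/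

section Compact

variable [CompactSpace H]

/-- The joint image of finitely many continuous characters `G → ℤ_l` of a compact group is a
`ℤ_l`-submodule of `ℤ_lⁿ`: it is a closed subgroup, and closed subgroups of `ℤ_lⁿ` are
`ℤ_l`-stable since `ℕ` is dense in `ℤ_l`. [cite: MochizukiAbsAnab2004, Lemma 1.1.4 (ii) proof p.8] -/
theorem exists_submodule_coe_eq_range (l : ℕ) [Fact l.Prime] {n : ℕ}
    (F : H →ₜ* Multiplicative (Fin n → ℤ_[l])) :
    ∃ N : Submodule ℤ_[l] (Fin n → ℤ_[l]),
      (N : Set (Fin n → ℤ_[l])) = Set.range (fun h => Multiplicative.toAdd (F h)) := by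
  set S : Set (Fin n → ℤ_[l]) := Set.range (fun h => Multiplicative.toAdd (F h)) with hS
  have hSc : IsClosed S :=
    (isCompact_range (continuous_toAdd.comp F.continuous)).isClosed
  have hadd : ∀ {x y}, x ∈ S → y ∈ S → x + y ∈ S := by
    rintro x y ⟨a, rfl⟩ ⟨b, rfl⟩
    exact ⟨a * b, by simp [map_mul]⟩
  have hnsmul : ∀ (k : ℕ) {x}, x ∈ S → (k : ℤ_[l]) • x ∈ S := by
    rintro k x ⟨a, rfl⟩
    refine ⟨a ^ k, ?_⟩
    simp only [map_pow, toAdd_pow]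
    rw [Nat.cast_smul_eq_nsmul]
  refine ⟨{ carrier := S
            zero_mem' := ⟨1, by simp⟩
            add_mem' := fun hx hy => hadd hx hy
            smul_mem' := fun c x hx => ?_ }, rfl⟩
  -- `c • x ∈ S` by density of `ℕ` in `ℤ_l` and closedness of `S`
  have hcont : Continuous fun d : ℤ_[l] => d • x := continuous_id.smul continuous_const
  exact PadicInt.denseRange_natCast.induction_on c (hSc.preimage hcont) fun k => hnsmul k hx

/-- **Independent characters give a surjection onto `ℤ_lⁿ`.**  If `G` is compact and
`φ₁, …, φₙ : G → ℤ_l` are continuous homomorphisms, linearly independent over `ℚ_l` as `ℚ_l`-valued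
functions on `G`, then `G` surjects continuously onto `ℤ_lⁿ`; hence `n ≤ δ¹_l(G)`.  (The joint
image is a free `ℤ_l`-module — Smith normal form over the PID `ℤ_l` — of full rank `n`, since an
unused Smith index would give a nonzero `ℤ_l`-linear relation `Σ λ_j φ_j = 0`.)  This is the
identification `δ¹_l(Π) = dim_{ℚ_l}(Π^{ab} ⊗ ℚ_l)` underlying [AbsAnab] Lemma 1.1.4 (ii).
[cite: MochizukiAbsAnab2004, Lemma 1.1.4 (ii) proof p.8] -/
theorem le_freeProlRank_of_linearIndependent (l : ℕ) [Fact l.Prime] {n : ℕ}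
    (φ : Fin n → (H →ₜ* Multiplicative ℤ_[l]))
    (hli : LinearIndependent ℚ_[l]
      (fun (i : Fin n) (h : H) => ((Multiplicative.toAdd (φ i h) : ℤ_[l]) : ℚ_[l]))) :
    (n : ℕ∞) ≤ freeProlRank H l := by
  classical
  -- bundle the characters into one continuous homomorphism `F : G → ℤ_lⁿ`
  let F : H →ₜ* Multiplicative (Fin n → ℤ_[l]) :=
    { toFun := fun h => Multiplicative.ofAdd fun i => Multiplicative.toAdd (φ i h)
      map_one' := by simp; rfl
      map_mul' := fun a b => by
        rw [← ofAdd_add]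
        congr 1
        funext i
        simp [map_mul]
      continuous_toFun := continuous_ofAdd.comp
        (continuous_pi fun i => continuous_toAdd.comp (φ i).continuous) }
  have hF : ∀ h i, Multiplicative.toAdd (F h) i = Multiplicative.toAdd (φ i h) := fun h i => rfl
  obtain ⟨N, hN⟩ := exists_submodule_coe_eq_range l F
  have hmemN : ∀ h, Multiplicative.toAdd (F h) ∈ N := fun h => by
    rw [← SetLike.mem_coe, hN]; exact ⟨h, rfl⟩
  -- Smith normal form of `N ≤ ℤ_lⁿ`
  obtain ⟨r, snf⟩ := Submodule.smithNormalForm (Pi.basisFun ℤ_[l] (Fin n)) N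
  have hrn : r ≤ n := by simpa using Fintype.card_le_of_embedding snf.f
  -- full rank: every index of the ambient basis is hit by `snf.f`
  have hnr : n ≤ r := by
    by_contra hlt
    push Not at hlt
    have hne : Set.range snf.f ≠ Set.univ := by
      intro huniv
      have hc : Fintype.card (Set.range snf.f) = r := by
        rw [Set.card_range_of_injective snf.f.injective]; simp
      have hc' : Fintype.card (Set.range snf.f) = n := by
        rw [Fintype.card_congr (Equiv.setCongr huniv), Fintype.card_congr (Equiv.Set.univ _)]
        simp
      omega
    obtain ⟨i, hi⟩ := (Set.ne_univ_iff_exists_notMem _).mp hne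
    have hker := snf.le_ker_coord_of_notMem_range hi
    -- the coordinate functional `λ = coord i` vanishes on the image of `F`
    set lam := snf.bM.coord i with hlam
    have hvan : ∀ h, lam (Multiplicative.toAdd (F h)) = 0 := fun h =>
      LinearMap.mem_ker.mp (hker (hmemN h))
    -- expand `λ` along the standard basis: `λ x = Σ_j x_j • λ e_j`
    have hrel : ∀ h, ∑ j, Multiplicative.toAdd (φ j h) *
        lam (fun k => if j = k then (1 : ℤ_[l]) else 0) = 0 := by
      intro h
      have := hvan h
      rw [LinearMap.pi_apply_eq_sum_univ] at this
      simpa [hF, smul_eq_mul] using this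
    -- hence a `ℚ_l`-linear relation among the `φ_j`, so all `λ e_j = 0`
    have hcoef : ∀ j, lam (fun k => if j = k then (1 : ℤ_[l]) else 0) = 0 := by
      have h0 := Fintype.linearIndependent_iff.mp hli
        (fun j => ((lam (fun k => if j = k then (1 : ℤ_[l]) else 0) : ℤ_[l]) : ℚ_[l])) ?_
      · intro j
        exact PadicInt.coe_eq_zero.mp (h0 j)
      · funext h
        simp only [Finset.sum_apply, Pi.smul_apply, smul_eq_mul, Pi.zero_apply]
        have := congrArg (fun z : ℤ_[l] => (z : ℚ_[l])) (hrel h)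
        simpa [mul_comm] using this
    have hzero : lam = 0 := by
      refine LinearMap.ext fun x => ?_
      rw [LinearMap.pi_apply_eq_sum_univ lam x]
      simp [hcoef]
    have hone : lam (snf.bM i) = 1 := by
      simp [hlam, Module.Basis.coord_apply]
    rw [hzero] at hone
    exact zero_ne_one hone
  obtain rfl : r = n := le_antisymm hrn hnr
  -- identify `N ≅ ℤ_lⁿ` along the Smith basis, bicontinuously
  let e : N ≃ₗ[ℤ_[l]] (Fin r → ℤ_[l]) := snf.bN.equivFun
  have hsymm : Continuous e.symm := by
    refine continuous_induced_rng.2 ?_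
    have : ((↑) : N → (Fin r → ℤ_[l])) ∘ e.symm =
        fun c : Fin r → ℤ_[l] => ∑ i, c i • (snf.bN i : Fin r → ℤ_[l]) := by
      funext c
      simp [e, Module.Basis.equivFun_symm_apply]
    rw [this]
    exact continuous_finsetSum _ fun i _ => (continuous_apply i).smul continuous_const
  have he : Continuous e := by
    have h := hsymm.continuous_symm_of_equiv_compact_to_t2 (f := e.symm.toEquiv)
    rwa [show ((e.symm.toEquiv.symm : N ≃ (Fin r → ℤ_[l])) : N → (Fin r → ℤ_[l])) = e from
      funext fun y => rfl] at h
  let G : H → N := fun h => ⟨Multiplicative.toAdd (F h), hmemN h⟩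
  have hG : Continuous G := (continuous_toAdd.comp F.continuous).subtype_mk _
  have hGmul : ∀ a b, G (a * b) = G a + G b := fun a b => by
    ext; simp [G, map_mul]
  let F' : H →ₜ* Multiplicative (Fin r → ℤ_[l]) :=
    { toFun := fun h => Multiplicative.ofAdd (e (G h))
      map_one' := by
        have : G 1 = 0 := by ext; simp [G]
        simp [this]
      map_mul' := fun a b => by rw [hGmul, map_add, ofAdd_add]
      continuous_toFun := continuous_ofAdd.comp (he.comp hG) }
  have hsurj : Function.Surjective F' := by
    intro y
    obtain ⟨h, hh⟩ : ∃ h, Multiplicative.toAdd (F h) = (e.symm (Multiplicative.toAdd y) : N) := by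
      have hm := (e.symm (Multiplicative.toAdd y)).2
      rw [← SetLike.mem_coe, hN] at hm
      exact hm
    refine ⟨h, ?_⟩
    have hGh : G h = e.symm (Multiplicative.toAdd y) := Subtype.ext hh
    change Multiplicative.ofAdd (e (G h)) = y
    rw [hGh, e.apply_symm_apply, ofAdd_toAdd]
  exact le_freeProlRank_of_surjective_aux l F' hsurj

end Compact

end Literature.AnabelianGeometry.AbsoluteAnabelian
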